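/-
Copyright (c) 2026 the pub-hodgecm-mathlib formalisation cell (harness21).  Prover seat hodgecm-mathlib-LH4-p08 (g12), req620 Track A «(D-RAM) FOUR-FRAME» squad
(STAGE-1b, row (2) of the piece `f_{T₊}`, the (β₂) road (R-36), the K6 road; K6 desk LH4-p16 (g3) WORD #17 node A5 ∕ WORD #18 (d) «p08: A5-dens THE TOP CELL'S DENSITY
AND CLASS SPLIT» — feeds LH4-p12 (g9)'s A5 `htop`), 2026-09-05.
-/
import Summits.HodgeConjecture.HodgeConjecture.Theorems.F0P3cDyRamRowCellDigitClassBalance    -- ★ p864600 (LH7-p08 (g3), Q1b): `two_mul_card_filter_class_eq_card`, `card_filter_class_of_far`;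
                                                                                             -- brings ★ p864480 (d′) frame letters, ★ p864361 `filter_sphere_and_eq_filter_{shell,of_radius_one}`
import Summits.HodgeConjecture.HodgeConjecture.Theorems.F0P3cDyRamRowCellDigitClassBoundary   -- ★ p864685 (LH4-p11 (g11), Q2): `two_mul_card_filter_class_boundary`, `…class'_boundary`,
                                                                                             -- `exists_slope`; brings ★ p864509 `card_filter_level_eq`, `card_filter_ball_eq`
import Literature.NumberTheory.LocalFields.WildQuadraticDatumNormOneQuotient                 -- ★ Lit `two_le_of_v_two_lt_one`
import HarnessLib

/-!
# Crux `H413`, line LH4 «(D-RAM) FOUR-FRAME» — STAGE-1b, row (2), the (β₂) road (R-36), K6 node A5-dens: «THE TOP CELL'S DENSITY AND CLASS SPLIT» — in the TOP chart the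
# top cell's two weighted sizes are ONE integer multiple `φ = 2·q^{2b+N−s}` of its two literal digit counts, in every regime of `N` against `d`

Cell `hodgecm-mathlib` (D-0151), FLOOR 0, crux item H413 = `stmt-HodgeConjecture-24833`, route of record `HCCMUnconditional`; squad F0∕P3c∕LH4; lane
`--supports stmt-HodgeConjecture-24833 --as helper` (count-neutral; pays NO tier-0 row).  THEOREMS ONLY (no `def`, no instance, no notation, no `sorry`, default heartbeats);
★-only imports; states NO law; ‹CORE›∕‹CORE-ODD› and (β₂) stay HYPOTHESES of their consumers.

WHAT (K6 desk LH4-p16 (g3) WORD #17 node A5 «THE TOP CELL IDENTITY `htop`» + WORD #18 (d) + WORD #19).  The top cell `i = N` of the live row (`N = (jl − m)∕2`, level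
`j = b + 2N`) is read in the TOP chart (`κ₀ + ρκ₀ = 1`, `|κ₀| = 1`, `ρξ₀ = −ξ₀`, `|ξ₀| = exp 2N`) over ONE complete irredundant system `Rd` of σ-fixed integral digits modulo
`|ϖ|^n` (`2d − 1 ≤ n`); its literal digit sets are `S_t := Rd.filter (LIT_t)` in ★ F1b p864627's ∕ ★ F1b-top p864859's literal lambda (SPHERE clause
`|κ₀ + jE V·ξ₀|·|jE ϖ^j·(α − ρα)| = |jE ϖ|^b` ∧ CLASS clause `∃ e, ρe = e ∧ e·Θe = N_ρ(κ₀ + jE V·ξ₀)∕(h_t·ρh_t)`, `h_H = h`, `h_A = h′`).  The top laws need the DENSITY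
letter `n_t(N) = φ·#S_t(N)` with ONE `φ` for both frames.  THIS FILE:
* §1 `topDensity_of_letters` — PURE `ℤ` ARITHMETIC: the top-index SIZE letters in ★ `density_of_tables`' byte shape (diagonal `N = 0`: `q^{2b}` both; inner `1 ≤ N`, `N + 1 < d`:
  `(q−1)q^{N−1}q^{2b}` both; boundary `N + 1 = d`: `(q−2)q^{N−1}q^{2b}` ∕ `q^N q^{2b}`; far `d ≤ N`: `2(q−1)q^{N−1}q^{2b}` for H — ★ p864432 ∘ ★ `rowSize_diag`, the assembler's
  plumbing) and §2's COUNT letters give **`n_H = φ·L_H ∧ (N < d → n_A = φ·L_A)`, `φ := 2·q^{2b+N−s}`**, `s = (n+1)∕2` the digit depth, under `s ≤ 2b + N` (integrality).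
* §2 `topSphere_classSplit` — THE CLASS SPLIT OF THE TOP SPHERE, instantiated: `2L_t = q^s` (diagonal, ★ Q1b at `R = 1`), `2L_t = (q−1)q^{s−1}` (inner, ★ Q1b at `R = |ξ₀|`),
  `2L_H = (q−2)q^{s−1} ∧ 2L_A = q^s` (boundary, ★ Q2 at `t = 0`), `L_H = (q−1)q^{s−1}` (far, ★ `card_filter_class_of_far`), `L_t := #(Rd.filter LIT_t)` in F1b's bytes (★ p864361
  `filter_sphere_and_eq_filter_shell` ∕ `…_of_radius_one` turn the SPHERE clause into `|V| = 1` ∕ `True`; ★ p864509 counts the unit sphere ∕ the ball).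
* §3 HEAD **`topCell_density`** = §2 ∘ §1 with `φ` EXPLICIT; `topCell_density_exists` — the desk's `∃ φ` bytes.  §4 `htop_of_solved` — the `htop` arithmetic (WORD #19).
WHAT IS NOT CLAIMED: the sizes (letters; ★ p864432), the top laws (★ F1b-top), `htop` itself (A5), (g-top) (★ p864688); any census identity.
HONEST LABEL.  Count-neutral bookkeeping over ★ counts; nothing printed is asserted; `HC_CM` is proved only modulo the 7 printed citations (2 remaining named inputs: hLiu418 =
`stmt-HodgeConjecture-24832`, h413 = `stmt-HodgeConjecture-24833`) until rung 0 closes.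
## References
* [Kottwitz1986BaseChangeUnits] R. E. Kottwitz, *Base change for unit elements of Hecke algebras*, Compositio Math. 60 (1986): §1 pp. 240–241 (cell-by-cell fixed-lattice counts).
* [Flicker1998UnitaryFL] Y. Z. Flicker, *Elementary proof of the fundamental lemma for a unitary group*, Canad. J. Math. 50 (1998): Prop. 7 p. 84 (the level tables by classes).
* [Serre1979] J.-P. Serre, *Local Fields*, GTM 67 (1979): Ch. V §3 Prop. 5, Cor. 2–3 pp. 84–86 (norm index two, residue counts), Ch. XV §2 (the conductor).
* [Rogawski1990] J. D. Rogawski, *Automorphic Representations of Unitary Groups in Three Variables*, Ann. of Math. Stud. 123 (1990): §4.9 Prop. 4.9.1 (b) p. 55.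
-/

set_option autoImplicit false

noncomputable section

namespace Summit.HodgeConjecture.HodgeConjecture.Cruxes.H413.F0P3cDyRamTopCellDensity

open scoped Valued WithZero Matrix MatrixGroups
open WithZero Finset
open Literature.NumberTheory.Automorphic Literature.NumberTheory.Automorphic.UnitaryGroup Literature.NumberTheory.Automorphic.UnitaryLatticeTree
open Literature.NumberTheory.Automorphic.UnitaryThreeFourFrame (IsRamifiedQuadraticDatum)
open Literature.NumberTheory.LocalFields.WildQuadraticDatum (two_le_of_v_two_lt_one)
open Summit.HodgeConjecture.HodgeConjecture.Cruxes.H413.F0P3cDyRamRowCellDigitShellDictionary (filter_sphere_and_eq_filter_shell filter_sphere_and_eq_filter_of_radius_one)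
open Summit.HodgeConjecture.HodgeConjecture.Cruxes.H413.F0P3cDyRamOneChartDigitTotals (card_filter_level_eq card_filter_ball_eq)
open Summit.HodgeConjecture.HodgeConjecture.Cruxes.H413.F0P3cDyRamRowCellDigitClassBalance (two_mul_card_filter_class_eq_card card_filter_class_of_far)
open Summit.HodgeConjecture.HodgeConjecture.Cruxes.H413.F0P3cDyRamRowCellDigitClassBoundary (exists_slope two_mul_card_filter_class_boundary two_mul_card_filter_class'_boundary)

/-! ## §1 Pure arithmetic: the top-index size letters and the top-sphere class counts give ONE quotient `φ = 2·q^{2b+N−s}` -/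

/-- **THE TOP DENSITY FROM THE LETTERS** (pure `ℤ` arithmetic; no field).  Integers `q ≥ 2`, the row `b`, the conductor exponent `d ≥ 2`, the window `N`, the digit depth `s ≥ 1` with
`s ≤ 2b + N`; the two SIZES `nH nA` of the top cell with their ★ table values at the top index `N` (★ p864432 ∕ ★ `rowSize_diag` shapes = ★ `density_of_tables`' letters at `i := N`):
diagonal `N = 0`, inner `1 ≤ N`, `N + 1 < d`, boundary `N + 1 = d`, far `d ≤ N` (H only); the two literal digit COUNTS `LH LA` of the top sphere with the §2 values.  THEN
**`nH = 2·q^{2b+N−s}·LH ∧ (N < d → nA = 2·q^{2b+N−s}·LA)`**. [cite: Kottwitz1986BaseChangeUnits, §1 pp. 240–241] [cite: Flicker1998UnitaryFL, Prop. 7 p. 84] -/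
theorem topDensity_of_letters (q : ℤ) (b d N s : ℕ) (hs1 : 1 ≤ s) (hsb : s ≤ 2 * b + N) (nH nA LH LA : ℤ)
    -- the size letters at the top index (★ `density_of_tables`' shapes at `i := N`)
    (hn0 : N = 0 → nH = q ^ (2 * b) ∧ nA = q ^ (2 * b))
    (hnNear : 1 ≤ N → N + 1 < d → nH = (q - 1) * q ^ (N - 1) * q ^ (2 * b) ∧ nA = (q - 1) * q ^ (N - 1) * q ^ (2 * b))
    (hnBd : 1 ≤ N → N + 1 = d → nH = (q - 2) * q ^ (N - 1) * q ^ (2 * b) ∧ nA = q ^ N * q ^ (2 * b))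
    (hnFar : 1 ≤ N → d ≤ N → nH = 2 * (q - 1) * q ^ (N - 1) * q ^ (2 * b))
    -- the count letters of the top sphere (§2)
    (hL0 : N = 0 → 2 * LH = q ^ s ∧ 2 * LA = q ^ s)
    (hLNear : 1 ≤ N → N + 1 < d → 2 * LH = (q - 1) * q ^ (s - 1) ∧ 2 * LA = (q - 1) * q ^ (s - 1))
    (hLBd : 1 ≤ N → N + 1 = d → 2 * LH = (q - 2) * q ^ (s - 1) ∧ 2 * LA = q ^ s)
    (hLFar : 1 ≤ N → d ≤ N → LH = (q - 1) * q ^ (s - 1)) :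
    nH = 2 * q ^ (2 * b + N - s) * LH ∧ (N < d → nA = 2 * q ^ (2 * b + N - s) * LA) := by
  -- the exponent bookkeeping: `q^{2b+N} = q^K·q^s`, `K := 2b + N − s`
  set K : ℕ := 2 * b + N - s with hK
  have hKs : K + s = 2 * b + N := by omega
  rcases Nat.eq_zero_or_pos N with hN0 | hN1
  · -- diagonal top cell
    subst hN0
    obtain ⟨h1, h2⟩ := hn0 rfl
    obtain ⟨h3, h4⟩ := hL0 rfl
    have e : q ^ (2 * b) = q ^ K * q ^ s := by rw [← pow_add]; congr 1; omega
    refine ⟨by linear_combination h1 + e - q ^ K * h3, fun _ => by linear_combination h2 + e - q ^ K * h4⟩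
  · have e : q ^ (N - 1) * q ^ (2 * b) = q ^ K * q ^ (s - 1) := by
      rw [← pow_add, ← pow_add]; congr 1; omega
    have e' : q ^ N * q ^ (2 * b) = q ^ K * q ^ s := by
      rw [← pow_add, ← pow_add]; congr 1; omega
    rcases Nat.lt_trichotomy (N + 1) d with hlt | heq | hgt
    · obtain ⟨h1, h2⟩ := hnNear hN1 hlt
      obtain ⟨h3, h4⟩ := hLNear hN1 hlt
      refine ⟨by linear_combination h1 + (q - 1) * e - q ^ K * h3, fun _ => by linear_combination h2 + (q - 1) * e - q ^ K * h4⟩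
    · obtain ⟨h1, h2⟩ := hnBd hN1 heq
      obtain ⟨h3, h4⟩ := hLBd hN1 heq
      refine ⟨by linear_combination h1 + (q - 2) * e - q ^ K * h3, fun _ => by linear_combination h2 + e' - q ^ K * h4⟩
    · have hdN : d ≤ N := by omega
      refine ⟨?_, fun h => absurd h (by omega)⟩
      have h1 := hnFar hN1 hdN
      have h3 := hLFar hN1 hdN
      linear_combination h1 + 2 * (q - 1) * e - 2 * q ^ K * h3

/-! ## §2 The class split of the top sphere, instantiated in the TOP chart (★ Q1b ∕ Q2 ∕ far counts + ★ p864361's dictionary + ★ p864509's totals) -/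

variable {E M : Type} [Field E] [Valued E ℤᵐ⁰] [Field M] [Valued M ℤᵐ⁰] {ρ Θ : M →+* M} {α : M}

/-- **THE CLASS SPLIT OF THE TOP SPHERE** (K6 A5-dens, count half).  Ramified datum `(σ, ϖ; d, t_E)` on a complete `E` with finite residue field `q = #𝓀[E]`, `|2| < 1`; the
embedding letters `jE` (`hjfix hΘj hjiso`) and the involutions `ρ, Θ` (`hρρ hvρ hΘρ`); the two frames in ★ p864480's currency (`P₁ dg η hA hηN`, the H-line `(φ, h)` of the hyperbolic
plane and the A-line `(φ′, h′)` of `diagonal dg`); the TOP chart `κ₀ + ρκ₀ = 1`, `Θκ₀ = κ₀`, `|κ₀| = 1`, `ρξ₀ = −ξ₀`, `Θξ₀ = ξ₀`, `|ξ₀| = exp 2N`; lane B `|α − ρα| = 1`; the top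
cell `j = b + 2N`; ONE complete irredundant system `Rd` of σ-fixed integral digits modulo `|ϖ|^n`, `2d − 1 ≤ n`; the two literal digit sets `Rd.filter LIT_t` in ★ F1b's bytes
(decidability instances as binders).  THEN with `s := (n + 1)∕2` and `L_t := #(Rd.filter LIT_t)`: diagonal `N = 0`: `2L_H = q^s ∧ 2L_A = q^s`; inner `1 ≤ N`, `N + 1 < d`:
`2L_t = (q−1)q^{s−1}` both; boundary `N + 1 = d`: `2L_H = (q−2)q^{s−1} ∧ 2L_A = q^s`; far `d ≤ N`: `L_H = (q−1)q^{s−1}`.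
[cite: Flicker1998UnitaryFL, Prop. 7 p. 84] [cite: Serre1979, Ch. V §3 Prop. 5, Cor. 2–3 pp. 84–86; Ch. XV §2] [cite: Kottwitz1986BaseChangeUnits, §1 pp. 240–241] -/
theorem topSphere_classSplit [CompleteSpace E] [Finite 𝓀[E]] {σ : E →+* E} {ϖ : E} {d tE : ℕ}
    (hD : IsRamifiedQuadraticDatum σ ϖ d tE) (h2v : Valued.v (2 : E) < 1)
    (jE : E →+* M) (hjfix : ∀ z, ρ z = z ↔ ∃ c, jE c = z) (hΘj : ∀ c, Θ (jE c) = jE (σ c)) (hjiso : ∀ a, Valued.v (jE a) = Valued.v a)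
    (hρρ : ∀ x, ρ (ρ x) = x) (hvρ : ∀ x, Valued.v (ρ x) = Valued.v x) (hΘρ : ∀ x, Θ (ρ x) = ρ (Θ x))
    -- the two frames (★ p864480's currency)
    (P₁ : GL (Fin 3) E) (dg : Fin 2 → E) (η : E)
    (hA : formCongr σ P₁ ((StdForm.antidiagonal 3).over E) =
      (!![(Matrix.diagonal dg) 0 0, 0, (Matrix.diagonal dg) 0 1; 0, η, 0; (Matrix.diagonal dg) 1 0, 0, (Matrix.diagonal dg) 1 1] : Matrix (Fin 3) (Fin 3) E))
    (hηN : ¬ ∃ t : E, t * σ t = η)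
    (φ : (Fin 2 → E) →+ M) {h : M} (hform : ∀ x y, jE (pairing σ ((StdForm.antidiagonal 2).over E) x y) = h * Θ (φ x) * φ y + ρ (h * Θ (φ x) * φ y))
    (hΘh : Θ h = h) (hh : h ≠ 0)
    (φ' : (Fin 2 → E) →+ M) {h' : M} (hform' : ∀ x y, jE (pairing σ (Matrix.diagonal dg) x y) = h' * Θ (φ' x) * φ' y + ρ (h' * Θ (φ' x) * φ' y))
    (hΘh' : Θ h' = h') (hh' : h' ≠ 0)
    -- the TOP chart
    {κ₀ ξ₀ : M} (hκ₀ : κ₀ + ρ κ₀ = 1) (hΘκ₀ : Θ κ₀ = κ₀) (hκ₀1 : Valued.v κ₀ = 1) (hξ : ρ ξ₀ = -ξ₀) (hΘξ : Θ ξ₀ = ξ₀)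
    {N : ℕ} (hξN : Valued.v ξ₀ = exp (2 * (N : ℤ)))
    -- lane B and the top cell
    (hU : Valued.v (α - ρ α) = 1) {b j : ℕ} (hjN : b + 2 * N = j)
    -- the digit system
    (Rd : Finset E) {n : ℕ} (hRd1 : ∀ V ∈ Rd, σ V = V ∧ Valued.v V ≤ 1)
    (hRd2 : ∀ V : E, σ V = V → Valued.v V ≤ 1 → ∃ V₀ ∈ Rd, Valued.v (V - V₀) ≤ Valued.v ϖ ^ n)
    (hRd3 : ∀ V ∈ Rd, ∀ V' ∈ Rd, Valued.v (V - V') ≤ Valued.v ϖ ^ n → V = V') (hn : 2 * d - 1 ≤ n)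
    [DecidablePred fun V₀ : E => Valued.v (κ₀ + jE V₀ * ξ₀) * Valued.v (jE ϖ ^ j * (α - ρ α)) = Valued.v (jE ϖ) ^ b ∧
      ∃ e : M, ρ e = e ∧ e * Θ e = (κ₀ + jE V₀ * ξ₀) * ρ (κ₀ + jE V₀ * ξ₀) / (h * ρ h)]
    [DecidablePred fun V₀ : E => Valued.v (κ₀ + jE V₀ * ξ₀) * Valued.v (jE ϖ ^ j * (α - ρ α)) = Valued.v (jE ϖ) ^ b ∧
      ∃ e : M, ρ e = e ∧ e * Θ e = (κ₀ + jE V₀ * ξ₀) * ρ (κ₀ + jE V₀ * ξ₀) / (h' * ρ h')] :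
    (N = 0 →
      2 * ((Rd.filter fun V₀ : E => Valued.v (κ₀ + jE V₀ * ξ₀) * Valued.v (jE ϖ ^ j * (α - ρ α)) = Valued.v (jE ϖ) ^ b ∧
          ∃ e : M, ρ e = e ∧ e * Θ e = (κ₀ + jE V₀ * ξ₀) * ρ (κ₀ + jE V₀ * ξ₀) / (h * ρ h)).card : ℤ) = (Nat.card 𝓀[E] : ℤ) ^ ((n + 1) / 2) ∧
      2 * ((Rd.filter fun V₀ : E => Valued.v (κ₀ + jE V₀ * ξ₀) * Valued.v (jE ϖ ^ j * (α - ρ α)) = Valued.v (jE ϖ) ^ b ∧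
          ∃ e : M, ρ e = e ∧ e * Θ e = (κ₀ + jE V₀ * ξ₀) * ρ (κ₀ + jE V₀ * ξ₀) / (h' * ρ h')).card : ℤ) = (Nat.card 𝓀[E] : ℤ) ^ ((n + 1) / 2)) ∧
    (1 ≤ N → N + 1 < d →
      2 * ((Rd.filter fun V₀ : E => Valued.v (κ₀ + jE V₀ * ξ₀) * Valued.v (jE ϖ ^ j * (α - ρ α)) = Valued.v (jE ϖ) ^ b ∧
          ∃ e : M, ρ e = e ∧ e * Θ e = (κ₀ + jE V₀ * ξ₀) * ρ (κ₀ + jE V₀ * ξ₀) / (h * ρ h)).card : ℤ) =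
        ((Nat.card 𝓀[E] : ℤ) - 1) * (Nat.card 𝓀[E] : ℤ) ^ ((n + 1) / 2 - 1) ∧
      2 * ((Rd.filter fun V₀ : E => Valued.v (κ₀ + jE V₀ * ξ₀) * Valued.v (jE ϖ ^ j * (α - ρ α)) = Valued.v (jE ϖ) ^ b ∧
          ∃ e : M, ρ e = e ∧ e * Θ e = (κ₀ + jE V₀ * ξ₀) * ρ (κ₀ + jE V₀ * ξ₀) / (h' * ρ h')).card : ℤ) =
        ((Nat.card 𝓀[E] : ℤ) - 1) * (Nat.card 𝓀[E] : ℤ) ^ ((n + 1) / 2 - 1)) ∧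
    (1 ≤ N → N + 1 = d →
      2 * ((Rd.filter fun V₀ : E => Valued.v (κ₀ + jE V₀ * ξ₀) * Valued.v (jE ϖ ^ j * (α - ρ α)) = Valued.v (jE ϖ) ^ b ∧
          ∃ e : M, ρ e = e ∧ e * Θ e = (κ₀ + jE V₀ * ξ₀) * ρ (κ₀ + jE V₀ * ξ₀) / (h * ρ h)).card : ℤ) =
        ((Nat.card 𝓀[E] : ℤ) - 2) * (Nat.card 𝓀[E] : ℤ) ^ ((n + 1) / 2 - 1) ∧
      2 * ((Rd.filter fun V₀ : E => Valued.v (κ₀ + jE V₀ * ξ₀) * Valued.v (jE ϖ ^ j * (α - ρ α)) = Valued.v (jE ϖ) ^ b ∧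
          ∃ e : M, ρ e = e ∧ e * Θ e = (κ₀ + jE V₀ * ξ₀) * ρ (κ₀ + jE V₀ * ξ₀) / (h' * ρ h')).card : ℤ) = (Nat.card 𝓀[E] : ℤ) ^ ((n + 1) / 2)) ∧
    (1 ≤ N → d ≤ N →
      ((Rd.filter fun V₀ : E => Valued.v (κ₀ + jE V₀ * ξ₀) * Valued.v (jE ϖ ^ j * (α - ρ α)) = Valued.v (jE ϖ) ^ b ∧
          ∃ e : M, ρ e = e ∧ e * Θ e = (κ₀ + jE V₀ * ξ₀) * ρ (κ₀ + jE V₀ * ξ₀) / (h * ρ h)).card : ℤ) =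
        ((Nat.card 𝓀[E] : ℤ) - 1) * (Nat.card 𝓀[E] : ℤ) ^ ((n + 1) / 2 - 1)) := by
  classical
  obtain ⟨hσ, hvσ, hϖ, hfix, hdiff, -, ht⟩ := id hD
  have hd2 : 2 ≤ d := two_le_of_v_two_lt_one hσ hvσ hfix hϖ hdiff ht h2v
  have hq1 : 1 < Nat.card 𝓀[E] := Finite.one_lt_card
  have hpow : ∀ k : ℕ, Valued.v ϖ ^ k = exp (-(k : ℤ)) := fun k => by
    rw [hϖ, ← exp_nsmul, nsmul_eq_mul, mul_neg, mul_one]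
  have hjpow : ∀ k : ℕ, Valued.v (jE ϖ) ^ k = exp (-(k : ℤ)) := fun k => by rw [hjiso, hpow]
  have hρj : ∀ c, ρ (jE c) = jE c := fun c => (hjfix (jE c)).2 ⟨c, rfl⟩
  have hξ0 : ξ₀ ≠ 0 := fun h0 => by rw [h0, map_zero] at hξN; exact (exp_ne_zero hξN.symm).elim
  have hRd1' : ∀ V ∈ Rd, Valued.v V ≤ 1 := fun V hV => (hRd1 V hV).2
  -- the class constants
  have hρc : ρ (h * ρ h) = h * ρ h := by rw [map_mul, hρρ, mul_comm]
  have hΘc : Θ (h * ρ h) = h * ρ h := by rw [map_mul, hΘρ, hΘh]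
  have hc0 : h * ρ h ≠ 0 := mul_ne_zero hh ((map_ne_zero ρ).2 hh)
  have hρc' : ρ (h' * ρ h') = h' * ρ h' := by rw [map_mul, hρρ, mul_comm]
  have hΘc' : Θ (h' * ρ h') = h' * ρ h' := by rw [map_mul, hΘρ, hΘh']
  have hc0' : h' * ρ h' ≠ 0 := mul_ne_zero hh' ((map_ne_zero ρ).2 hh')
  -- the sphere radius letter of the top cell: `|ξ₀|·|jEϖ^j·(α − ρα)| = |jEϖ|^b`
  have hvC : Valued.v (jE ϖ ^ j * (α - ρ α)) = exp (-(j : ℤ)) := by rw [map_mul, hU, mul_one, map_pow, hjpow]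
  have hξR : Valued.v ξ₀ * Valued.v (jE ϖ ^ j * (α - ρ α)) = Valued.v (jE ϖ) ^ b := by
    rw [hvC, hξN, hjpow, ← exp_add]; congr 1; omega
  have hcc : jE ϖ ^ j * (α - ρ α) ≠ 0 := fun h0 => by rw [h0, map_zero] at hvC; exact (exp_ne_zero hvC.symm).elim
  -- the digit totals: the unit sphere and the unit ball of `Rd`
  have hSPH : ((Rd.filter fun V => Valued.v V = 1).card : ℤ) = ((Nat.card 𝓀[E] : ℤ) - 1) * (Nat.card 𝓀[E] : ℤ) ^ ((n + 1) / 2 - 1) := by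
    have h1 := card_filter_level_eq hD Rd hRd1 hRd2 hRd3 0 (by omega)
    have hf : (Rd.filter fun V => Valued.v V = Valued.v ϖ ^ (2 * 0)) = Rd.filter fun V => Valued.v V = 1 := by
      simp only [mul_zero, pow_zero]
    rw [hf] at h1
    rw [h1, Nat.cast_mul, Nat.cast_sub hq1.le, Nat.cast_pow, Nat.cast_one]
    congr 2
  have hBALL : ((Rd.card : ℕ) : ℤ) = (Nat.card 𝓀[E] : ℤ) ^ ((n + 1) / 2) := by
    have h1 := card_filter_ball_eq hD Rd hRd1 hRd2 hRd3 0 (by omega)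
    have hf : (Rd.filter fun V => Valued.v V ≤ Valued.v ϖ ^ (2 * 0)) = Rd := by
      simp only [mul_zero, pow_zero]; exact filter_true_of_mem fun V hV => hRd1' V hV
    rw [hf] at h1
    rw [h1, Nat.cast_pow]
    congr 1
  refine ⟨fun hN0 => ?_, fun hN1 hlt => ?_, fun hN1 heq => ?_, fun hN1 hge => ?_⟩
  · -- DIAGONAL `N = 0`: `|ξ₀| = 1`, the sphere clause is automatic (`j = b`), the class split is half/half over all of `Rd` (★ Q1b at `R = 1`)
    subst hN0
    have hξ1 : Valued.v ξ₀ = 1 := by simp only [hξN, Nat.cast_zero, mul_zero, exp_zero]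
    have hR1 : Valued.v (jE ϖ ^ j * (α - ρ α)) = Valued.v (jE ϖ) ^ b := by
      rw [map_mul, hU, mul_one, map_pow, ← hjN, mul_zero, add_zero]
    have hfH := filter_sphere_and_eq_filter_of_radius_one hvρ jE hρj hjiso hR1 hκ₀ hκ₀1 hξ hξ1.le Rd hRd1'
      (fun V => ∃ e : M, ρ e = e ∧ e * Θ e = (κ₀ + jE V * ξ₀) * ρ (κ₀ + jE V * ξ₀) / (h * ρ h))
    have hfA := filter_sphere_and_eq_filter_of_radius_one hvρ jE hρj hjiso hR1 hκ₀ hκ₀1 hξ hξ1.le Rd hRd1'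
      (fun V => ∃ e : M, ρ e = e ∧ e * Θ e = (κ₀ + jE V * ξ₀) * ρ (κ₀ + jE V * ξ₀) / (h' * ρ h'))
    -- ★ Q1b at radius `1`: the whole digit ball
    have hmax : (Rd.filter fun V => max 1 (Valued.v V * Valued.v ξ₀) = 1) = Rd :=
      filter_true_of_mem fun V hV => max_eq_left (by rw [hξ1, mul_one]; exact hRd1' V hV)
    have hϖ1 : Valued.v ϖ ^ n < 1 := by rw [hpow, ← exp_zero, exp_lt_exp]; omega
    have hRin : (1 : ℤᵐ⁰) * Valued.v ϖ ^ (2 * d - 2) < 1 := by rw [one_mul, hpow, ← exp_zero, exp_lt_exp]; omega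
    have hrR : Valued.v ϖ ^ n * Valued.v ξ₀ < 1 := by rw [hξ1, mul_one]; exact hϖ1
    have hrc : Valued.v ϖ ^ n * Valued.v ξ₀ ≤ Valued.v ϖ ^ (2 * d - 1) * 1 := by
      rw [hξ1, mul_one, mul_one, hpow, hpow, exp_le_exp]; omega
    have hH := two_mul_card_filter_class_eq_card hD h2v hd2 jE hjfix hΘj hjiso hρρ hvρ hΘρ hκ₀ hΘκ₀ hκ₀1 hξ hΘξ hξ0 hρc hΘc hc0
      Rd hRd1 hRd2 hRd3 (R := 1) le_rfl hξ1.symm.le hRin hrR hrc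
    have hA' := two_mul_card_filter_class_eq_card hD h2v hd2 jE hjfix hΘj hjiso hρρ hvρ hΘρ hκ₀ hΘκ₀ hκ₀1 hξ hΘξ hξ0 hρc' hΘc' hc0'
      Rd hRd1 hRd2 hRd3 (R := 1) le_rfl hξ1.symm.le hRin hrR hrc
    rw [hmax] at hH hA'
    rw [hfH, hfA]
    constructor
    · rw [← hBALL]; exact_mod_cast hH
    · rw [← hBALL]; exact_mod_cast hA'
  · -- INNER `1 ≤ N`, `N + 1 < d`: ★ Q1b at `R = |ξ₀| = exp 2N`, both classes half/half of the unit sphere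
    have hlt' : Valued.v κ₀ < Valued.v ξ₀ := by rw [hκ₀1, hξN, ← exp_zero, exp_lt_exp]; omega
    have hfH := filter_sphere_and_eq_filter_shell jE hjiso hcc hlt' hξR Rd hRd1'
      (fun V => ∃ e : M, ρ e = e ∧ e * Θ e = (κ₀ + jE V * ξ₀) * ρ (κ₀ + jE V * ξ₀) / (h * ρ h))
    have hfA := filter_sphere_and_eq_filter_shell jE hjiso hcc hlt' hξR Rd hRd1'
      (fun V => ∃ e : M, ρ e = e ∧ e * Θ e = (κ₀ + jE V * ξ₀) * ρ (κ₀ + jE V * ξ₀) / (h' * ρ h'))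
    -- ★ Q1b's sphere filter at `R = |ξ₀|` is the unit sphere
    have h1lt : (1 : ℤᵐ⁰) < Valued.v ξ₀ := by rw [← hκ₀1]; exact hlt'
    have hξpos : 0 < Valued.v ξ₀ := zero_lt_iff.2 (by rw [hξN]; exact exp_ne_zero)
    have hmax : (Rd.filter fun V => max 1 (Valued.v V * Valued.v ξ₀) = Valued.v ξ₀) = Rd.filter fun V => Valued.v V = 1 := by
      refine filter_congr fun V hV => ⟨fun hm => ?_, fun h1 => ?_⟩
      · by_contra hne
        have hVlt : Valued.v V < 1 := lt_of_le_of_ne (hRd1' V hV) hne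
        have h2 : Valued.v V * Valued.v ξ₀ < Valued.v ξ₀ := by
          calc Valued.v V * Valued.v ξ₀ < 1 * Valued.v ξ₀ := mul_lt_mul_of_pos_right hVlt hξpos
            _ = Valued.v ξ₀ := one_mul _
        exact absurd hm (ne_of_lt (max_lt h1lt h2))
      · rw [h1, one_mul]; exact max_eq_right h1lt.le
    have hRin : Valued.v ξ₀ * Valued.v ϖ ^ (2 * d - 2) < 1 := by rw [hξN, hpow, ← exp_add, ← exp_zero, exp_lt_exp]; omega
    have hϖn : Valued.v ϖ ^ n < 1 := by rw [hpow, ← exp_zero, exp_lt_exp]; omega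
    have hrR : Valued.v ϖ ^ n * Valued.v ξ₀ < Valued.v ξ₀ := by
      calc Valued.v ϖ ^ n * Valued.v ξ₀ < 1 * Valued.v ξ₀ := mul_lt_mul_of_pos_right hϖn hξpos
        _ = Valued.v ξ₀ := one_mul _
    have hrc : Valued.v ϖ ^ n * Valued.v ξ₀ ≤ Valued.v ϖ ^ (2 * d - 1) * Valued.v ξ₀ :=
      mul_le_mul' (by rw [hpow, hpow, exp_le_exp]; omega) le_rfl
    have hH := two_mul_card_filter_class_eq_card hD h2v hd2 jE hjfix hΘj hjiso hρρ hvρ hΘρ hκ₀ hΘκ₀ hκ₀1 hξ hΘξ hξ0 hρc hΘc hc0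
      Rd hRd1 hRd2 hRd3 (R := Valued.v ξ₀) h1lt.le le_rfl hRin hrR hrc
    have hA' := two_mul_card_filter_class_eq_card hD h2v hd2 jE hjfix hΘj hjiso hρρ hvρ hΘρ hκ₀ hΘκ₀ hκ₀1 hξ hΘξ hξ0 hρc' hΘc' hc0'
      Rd hRd1 hRd2 hRd3 (R := Valued.v ξ₀) h1lt.le le_rfl hRin hrR hrc
    rw [hmax] at hH hA'
    rw [hfH, hfA, ← hSPH]
    exact ⟨by exact_mod_cast hH, by exact_mod_cast hA'⟩
  · -- BOUNDARY `N + 1 = d`: ★ Q2 at `t = 0` — the unit sphere splits `(q − 2) : q`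
    have hlt' : Valued.v κ₀ < Valued.v ξ₀ := by rw [hκ₀1, hξN, ← exp_zero, exp_lt_exp]; omega
    have hfH := filter_sphere_and_eq_filter_shell jE hjiso hcc hlt' hξR Rd hRd1'
      (fun V => ∃ e : M, ρ e = e ∧ e * Θ e = (κ₀ + jE V * ξ₀) * ρ (κ₀ + jE V * ξ₀) / (h * ρ h))
    have hfA := filter_sphere_and_eq_filter_shell jE hjiso hcc hlt' hξR Rd hRd1'
      (fun V => ∃ e : M, ρ e = e ∧ e * Θ e = (κ₀ + jE V * ξ₀) * ρ (κ₀ + jE V * ξ₀) / (h' * ρ h'))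
    obtain ⟨A₀, hA₀⟩ := exists_slope jE hjfix hρρ (κ₀ := κ₀) hξ hξ0
    have hH := two_mul_card_filter_class_boundary hD h2v hd2 jE hjfix hΘj hjiso hρρ hvρ hΘρ φ hform hκ₀ hΘκ₀ hκ₀1 hξ hΘξ hξN hA₀ Rd hRd1 hRd2 hRd3 0 (by omega) (by omega)
    have hA' := two_mul_card_filter_class'_boundary hD h2v hd2 jE hjfix hΘj hjiso hρρ hvρ hΘρ P₁ dg η hA hηN φ hform hΘh hh φ' hform' hΘh' hh'
      hκ₀ hΘκ₀ hκ₀1 hξ hΘξ hξN hA₀ Rd hRd1 hRd2 hRd3 0 (by omega) (by omega)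
    have hf0 : (Rd.filter fun V => Valued.v V = Valued.v ϖ ^ (2 * 0)) = Rd.filter fun V => Valued.v V = 1 := by
      simp only [mul_zero, pow_zero]
    rw [hf0] at hH hA'
    rw [hSPH] at hH hA'
    rw [hfH, hfA]
    -- cancel the factor `q − 1`
    have hq0 : ((Nat.card 𝓀[E] : ℤ) - 1) ≠ 0 := by
      have : (1 : ℤ) < (Nat.card 𝓀[E] : ℤ) := by exact_mod_cast hq1
      omega
    have hs1 : 1 ≤ (n + 1) / 2 := by omega
    have epow : (Nat.card 𝓀[E] : ℤ) ^ ((n + 1) / 2) = (Nat.card 𝓀[E] : ℤ) * (Nat.card 𝓀[E] : ℤ) ^ ((n + 1) / 2 - 1) := by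
      rw [← pow_succ']; congr 1; omega
    exact ⟨mul_left_cancel₀ hq0 (by linear_combination hH), mul_left_cancel₀ hq0 (by rw [epow]; linear_combination hA')⟩
  · -- FAR `d ≤ N`: the unit sphere is ONE-CLASS (★ `card_filter_class_of_far`)
    have hlt' : Valued.v κ₀ < Valued.v ξ₀ := by rw [hκ₀1, hξN, ← exp_zero, exp_lt_exp]; omega
    have hfH := filter_sphere_and_eq_filter_shell jE hjiso hcc hlt' hξR Rd hRd1'
      (fun V => ∃ e : M, ρ e = e ∧ e * Θ e = (κ₀ + jE V * ξ₀) * ρ (κ₀ + jE V * ξ₀) / (h * ρ h))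
    have hS : ∀ V ∈ Rd.filter (fun V => Valued.v V = 1), σ V = V ∧ exp (2 * (d : ℤ) - 1) ≤ Valued.v V * Valued.v ξ₀ := fun V hV =>
      ⟨(hRd1 V (mem_filter.1 hV).1).1, by rw [(mem_filter.1 hV).2, one_mul, hξN, exp_le_exp]; omega⟩
    have hfar := (card_filter_class_of_far hD jE hjfix hΘj hjiso hρρ hvρ hΘρ P₁ dg η hA hηN φ hform hΘh hh φ' hform' hΘh' hh'
      hκ₀ hΘκ₀ hκ₀1 hξ hΘξ _ hS).1
    rw [hfH, ← hSPH]
    exact_mod_cast hfar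

/-! ## §3 HEAD — the top cell's density: ONE explicit integer `φ = 2·q^{2b+N−s}` for both frames -/

/-- **HEAD — «THE TOP CELL'S DENSITY AND CLASS SPLIT» (K6 A5-dens, K6 desk LH4-p16 (g3) WORD #18 (d)).**  Frame of `topSphere_classSplit` (datum, embedding, involutions, the two
frames in ★ p864480's currency, the TOP chart `|κ₀| = 1`, `|ξ₀| = exp 2N`, lane B `|α − ρα| = 1`, the top cell `j = b + 2N`, ONE digit system `Rd` modulo `|ϖ|^n` with `2d − 1 ≤ n`)
plus the two SIZES `nH nA : ℤ` of the top cell as LETTERS with their ★ table values at the top index (`hn0 hnNear hnBd hnFar` — ★ p864432 `rowSize_near ∕ …boundary_hyp_allD ∕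
…boundary_aniso_allD ∕ …far_hyp_allD` ∘ ★ `rowSize_diag`, the assembler's plumbing) and the integrality bound `(n + 1)∕2 ≤ 2b + N` on the top precision.  THEN with
`φ := 2·q^{2b + N − (n+1)∕2}` (`q = #𝓀[E]`): **`nH = φ·#(Rd.filter LIT_H) ∧ (N < d → nA = φ·#(Rd.filter LIT_A))`** — the `hk_t` density letters of the top cell's two laws
(F1b-top, LH4-p12 (g9)), ONE `φ` for both frames, in every regime (`N = 0` diagonal, inner, boundary `N + 1 = d`, far `d ≤ N` where the A-frame carries no obligation).
[cite: Kottwitz1986BaseChangeUnits, §1 pp. 240–241] [cite: Flicker1998UnitaryFL, Prop. 7 p. 84] [cite: Serre1979, Ch. V §3 Prop. 5, Cor. 2–3 pp. 84–86]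
[cite: Rogawski1990, §4.9 Prop. 4.9.1 (b) p. 55] -/
theorem topCell_density [CompleteSpace E] [Finite 𝓀[E]] {σ : E →+* E} {ϖ : E} {d tE : ℕ}
    (hD : IsRamifiedQuadraticDatum σ ϖ d tE) (h2v : Valued.v (2 : E) < 1)
    (jE : E →+* M) (hjfix : ∀ z, ρ z = z ↔ ∃ c, jE c = z) (hΘj : ∀ c, Θ (jE c) = jE (σ c)) (hjiso : ∀ a, Valued.v (jE a) = Valued.v a)
    (hρρ : ∀ x, ρ (ρ x) = x) (hvρ : ∀ x, Valued.v (ρ x) = Valued.v x) (hΘρ : ∀ x, Θ (ρ x) = ρ (Θ x))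
    -- the two frames (★ p864480's currency)
    (P₁ : GL (Fin 3) E) (dg : Fin 2 → E) (η : E)
    (hA : formCongr σ P₁ ((StdForm.antidiagonal 3).over E) =
      (!![(Matrix.diagonal dg) 0 0, 0, (Matrix.diagonal dg) 0 1; 0, η, 0; (Matrix.diagonal dg) 1 0, 0, (Matrix.diagonal dg) 1 1] : Matrix (Fin 3) (Fin 3) E))
    (hηN : ¬ ∃ t : E, t * σ t = η)
    (φ : (Fin 2 → E) →+ M) {h : M} (hform : ∀ x y, jE (pairing σ ((StdForm.antidiagonal 2).over E) x y) = h * Θ (φ x) * φ y + ρ (h * Θ (φ x) * φ y))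
    (hΘh : Θ h = h) (hh : h ≠ 0)
    (φ' : (Fin 2 → E) →+ M) {h' : M} (hform' : ∀ x y, jE (pairing σ (Matrix.diagonal dg) x y) = h' * Θ (φ' x) * φ' y + ρ (h' * Θ (φ' x) * φ' y))
    (hΘh' : Θ h' = h') (hh' : h' ≠ 0)
    -- the TOP chart
    {κ₀ ξ₀ : M} (hκ₀ : κ₀ + ρ κ₀ = 1) (hΘκ₀ : Θ κ₀ = κ₀) (hκ₀1 : Valued.v κ₀ = 1) (hξ : ρ ξ₀ = -ξ₀) (hΘξ : Θ ξ₀ = ξ₀)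
    {N : ℕ} (hξN : Valued.v ξ₀ = exp (2 * (N : ℤ)))
    -- lane B and the top cell
    (hU : Valued.v (α - ρ α) = 1) {b j : ℕ} (hjN : b + 2 * N = j)
    -- the digit system and the top precision
    (Rd : Finset E) {n : ℕ} (hRd1 : ∀ V ∈ Rd, σ V = V ∧ Valued.v V ≤ 1)
    (hRd2 : ∀ V : E, σ V = V → Valued.v V ≤ 1 → ∃ V₀ ∈ Rd, Valued.v (V - V₀) ≤ Valued.v ϖ ^ n)
    (hRd3 : ∀ V ∈ Rd, ∀ V' ∈ Rd, Valued.v (V - V') ≤ Valued.v ϖ ^ n → V = V') (hn : 2 * d - 1 ≤ n) (hres : (n + 1) / 2 ≤ 2 * b + N)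
    [DecidablePred fun V₀ : E => Valued.v (κ₀ + jE V₀ * ξ₀) * Valued.v (jE ϖ ^ j * (α - ρ α)) = Valued.v (jE ϖ) ^ b ∧
      ∃ e : M, ρ e = e ∧ e * Θ e = (κ₀ + jE V₀ * ξ₀) * ρ (κ₀ + jE V₀ * ξ₀) / (h * ρ h)]
    [DecidablePred fun V₀ : E => Valued.v (κ₀ + jE V₀ * ξ₀) * Valued.v (jE ϖ ^ j * (α - ρ α)) = Valued.v (jE ϖ) ^ b ∧
      ∃ e : M, ρ e = e ∧ e * Θ e = (κ₀ + jE V₀ * ξ₀) * ρ (κ₀ + jE V₀ * ξ₀) / (h' * ρ h')]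
    -- the two sizes of the top cell, as letters (★ p864432 ∘ ★ `rowSize_diag` at the top index)
    (nH nA : ℤ)
    (hn0 : N = 0 → nH = (Nat.card 𝓀[E] : ℤ) ^ (2 * b) ∧ nA = (Nat.card 𝓀[E] : ℤ) ^ (2 * b))
    (hnNear : 1 ≤ N → N + 1 < d →
      nH = ((Nat.card 𝓀[E] : ℤ) - 1) * (Nat.card 𝓀[E] : ℤ) ^ (N - 1) * (Nat.card 𝓀[E] : ℤ) ^ (2 * b) ∧
        nA = ((Nat.card 𝓀[E] : ℤ) - 1) * (Nat.card 𝓀[E] : ℤ) ^ (N - 1) * (Nat.card 𝓀[E] : ℤ) ^ (2 * b))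
    (hnBd : 1 ≤ N → N + 1 = d →
      nH = ((Nat.card 𝓀[E] : ℤ) - 2) * (Nat.card 𝓀[E] : ℤ) ^ (N - 1) * (Nat.card 𝓀[E] : ℤ) ^ (2 * b) ∧
        nA = (Nat.card 𝓀[E] : ℤ) ^ N * (Nat.card 𝓀[E] : ℤ) ^ (2 * b))
    (hnFar : 1 ≤ N → d ≤ N → nH = 2 * ((Nat.card 𝓀[E] : ℤ) - 1) * (Nat.card 𝓀[E] : ℤ) ^ (N - 1) * (Nat.card 𝓀[E] : ℤ) ^ (2 * b)) :
    nH = 2 * (Nat.card 𝓀[E] : ℤ) ^ (2 * b + N - (n + 1) / 2) *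
        ((Rd.filter fun V₀ : E => Valued.v (κ₀ + jE V₀ * ξ₀) * Valued.v (jE ϖ ^ j * (α - ρ α)) = Valued.v (jE ϖ) ^ b ∧
          ∃ e : M, ρ e = e ∧ e * Θ e = (κ₀ + jE V₀ * ξ₀) * ρ (κ₀ + jE V₀ * ξ₀) / (h * ρ h)).card : ℤ) ∧
      (N < d → nA = 2 * (Nat.card 𝓀[E] : ℤ) ^ (2 * b + N - (n + 1) / 2) *
        ((Rd.filter fun V₀ : E => Valued.v (κ₀ + jE V₀ * ξ₀) * Valued.v (jE ϖ ^ j * (α - ρ α)) = Valued.v (jE ϖ) ^ b ∧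
          ∃ e : M, ρ e = e ∧ e * Θ e = (κ₀ + jE V₀ * ξ₀) * ρ (κ₀ + jE V₀ * ξ₀) / (h' * ρ h')).card : ℤ)) := by
  obtain ⟨hσ, hvσ, hϖ, hfix, hdiff, -, ht⟩ := id hD
  have hd2 : 2 ≤ d := two_le_of_v_two_lt_one hσ hvσ hfix hϖ hdiff ht h2v
  obtain ⟨h0, hnear, hbd, hfar⟩ := topSphere_classSplit hD h2v jE hjfix hΘj hjiso hρρ hvρ hΘρ P₁ dg η hA hηN φ hform hΘh hh φ' hform' hΘh' hh'
    hκ₀ hΘκ₀ hκ₀1 hξ hΘξ hξN hU hjN Rd hRd1 hRd2 hRd3 hn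
  exact topDensity_of_letters (Nat.card 𝓀[E] : ℤ) b d N ((n + 1) / 2) (by omega) hres nH nA _ _ hn0 hnNear hnBd hnFar h0 hnear hbd hfar

/-- **«THE TOP CELL'S DENSITY», `∃ φ` FORM** (the desk's A5-dens bytes): frame of `topCell_density` ⟹ `∃ φ : ℤ, nH = φ·#(Rd.filter LIT_H) ∧ (N < d → nA = φ·#(Rd.filter LIT_A))`.
[cite: Kottwitz1986BaseChangeUnits, §1 pp. 240–241] [cite: Flicker1998UnitaryFL, Prop. 7 p. 84] -/
theorem topCell_density_exists [CompleteSpace E] [Finite 𝓀[E]] {σ : E →+* E} {ϖ : E} {d tE : ℕ}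
    (hD : IsRamifiedQuadraticDatum σ ϖ d tE) (h2v : Valued.v (2 : E) < 1) (jE : E →+* M) (hjfix : ∀ z, ρ z = z ↔ ∃ c, jE c = z) (hΘj : ∀ c, Θ (jE c) = jE (σ c))
    (hjiso : ∀ a, Valued.v (jE a) = Valued.v a) (hρρ : ∀ x, ρ (ρ x) = x) (hvρ : ∀ x, Valued.v (ρ x) = Valued.v x) (hΘρ : ∀ x, Θ (ρ x) = ρ (Θ x)) (P₁ : GL (Fin 3) E) (dg : Fin 2 → E) (η : E)
    (hA : formCongr σ P₁ ((StdForm.antidiagonal 3).over E) =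
      (!![(Matrix.diagonal dg) 0 0, 0, (Matrix.diagonal dg) 0 1; 0, η, 0; (Matrix.diagonal dg) 1 0, 0, (Matrix.diagonal dg) 1 1] : Matrix (Fin 3) (Fin 3) E))
    (hηN : ¬ ∃ t : E, t * σ t = η) (φ : (Fin 2 → E) →+ M) {h : M}
    (hform : ∀ x y, jE (pairing σ ((StdForm.antidiagonal 2).over E) x y) = h * Θ (φ x) * φ y + ρ (h * Θ (φ x) * φ y)) (hΘh : Θ h = h) (hh : h ≠ 0) (φ' : (Fin 2 → E) →+ M) {h' : M}
    (hform' : ∀ x y, jE (pairing σ (Matrix.diagonal dg) x y) = h' * Θ (φ' x) * φ' y + ρ (h' * Θ (φ' x) * φ' y)) (hΘh' : Θ h' = h') (hh' : h' ≠ 0) {κ₀ ξ₀ : M} (hκ₀ : κ₀ + ρ κ₀ = 1)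
    (hΘκ₀ : Θ κ₀ = κ₀) (hκ₀1 : Valued.v κ₀ = 1) (hξ : ρ ξ₀ = -ξ₀) (hΘξ : Θ ξ₀ = ξ₀) {N : ℕ} (hξN : Valued.v ξ₀ = exp (2 * (N : ℤ))) (hU : Valued.v (α - ρ α) = 1) {b j : ℕ}
    (hjN : b + 2 * N = j) (Rd : Finset E) {n : ℕ} (hRd1 : ∀ V ∈ Rd, σ V = V ∧ Valued.v V ≤ 1)
    (hRd2 : ∀ V : E, σ V = V → Valued.v V ≤ 1 → ∃ V₀ ∈ Rd, Valued.v (V - V₀) ≤ Valued.v ϖ ^ n)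
    (hRd3 : ∀ V ∈ Rd, ∀ V' ∈ Rd, Valued.v (V - V') ≤ Valued.v ϖ ^ n → V = V') (hn : 2 * d - 1 ≤ n) (hres : (n + 1) / 2 ≤ 2 * b + N)
    [DecidablePred fun V₀ : E => Valued.v (κ₀ + jE V₀ * ξ₀) * Valued.v (jE ϖ ^ j * (α - ρ α)) = Valued.v (jE ϖ) ^ b ∧
      ∃ e : M, ρ e = e ∧ e * Θ e = (κ₀ + jE V₀ * ξ₀) * ρ (κ₀ + jE V₀ * ξ₀) / (h * ρ h)]
    [DecidablePred fun V₀ : E => Valued.v (κ₀ + jE V₀ * ξ₀) * Valued.v (jE ϖ ^ j * (α - ρ α)) = Valued.v (jE ϖ) ^ b ∧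
      ∃ e : M, ρ e = e ∧ e * Θ e = (κ₀ + jE V₀ * ξ₀) * ρ (κ₀ + jE V₀ * ξ₀) / (h' * ρ h')]
    (nH nA : ℤ) (hn0 : N = 0 → nH = (Nat.card 𝓀[E] : ℤ) ^ (2 * b) ∧ nA = (Nat.card 𝓀[E] : ℤ) ^ (2 * b))
    (hnNear : 1 ≤ N → N + 1 < d → nH = ((Nat.card 𝓀[E] : ℤ) - 1) * (Nat.card 𝓀[E] : ℤ) ^ (N - 1) * (Nat.card 𝓀[E] : ℤ) ^ (2 * b) ∧
        nA = ((Nat.card 𝓀[E] : ℤ) - 1) * (Nat.card 𝓀[E] : ℤ) ^ (N - 1) * (Nat.card 𝓀[E] : ℤ) ^ (2 * b))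
    (hnBd : 1 ≤ N → N + 1 = d → nH = ((Nat.card 𝓀[E] : ℤ) - 2) * (Nat.card 𝓀[E] : ℤ) ^ (N - 1) * (Nat.card 𝓀[E] : ℤ) ^ (2 * b) ∧ nA = (Nat.card 𝓀[E] : ℤ) ^ N * (Nat.card 𝓀[E] : ℤ) ^ (2 * b))
    (hnFar : 1 ≤ N → d ≤ N → nH = 2 * ((Nat.card 𝓀[E] : ℤ) - 1) * (Nat.card 𝓀[E] : ℤ) ^ (N - 1) * (Nat.card 𝓀[E] : ℤ) ^ (2 * b)) :
    ∃ φ₀ : ℤ,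
      nH = φ₀ * ((Rd.filter fun V₀ : E => Valued.v (κ₀ + jE V₀ * ξ₀) * Valued.v (jE ϖ ^ j * (α - ρ α)) = Valued.v (jE ϖ) ^ b ∧
          ∃ e : M, ρ e = e ∧ e * Θ e = (κ₀ + jE V₀ * ξ₀) * ρ (κ₀ + jE V₀ * ξ₀) / (h * ρ h)).card : ℤ) ∧
      (N < d → nA = φ₀ * ((Rd.filter fun V₀ : E => Valued.v (κ₀ + jE V₀ * ξ₀) * Valued.v (jE ϖ ^ j * (α - ρ α)) = Valued.v (jE ϖ) ^ b ∧
          ∃ e : M, ρ e = e ∧ e * Θ e = (κ₀ + jE V₀ * ξ₀) * ρ (κ₀ + jE V₀ * ξ₀) / (h' * ρ h')).card : ℤ)) :=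
  ⟨_, topCell_density hD h2v jE hjfix hΘj hjiso hρρ hvρ hΘρ P₁ dg η hA hηN φ hform hΘh hh φ' hform' hΘh' hh' hκ₀ hΘκ₀ hκ₀1 hξ hΘξ hξN hU hjN
    Rd hRd1 hRd2 hRd3 hn hres nH nA hn0 hnNear hnBd hnFar⟩

/-! ## §4 The `htop` arithmetic in SOLVED-VALUE form (K6 desk WORD #19; zero imports) -/

/-- **`htop` FROM THE SOLVED TOP VALUES** (K6 desk LH4-p16 (g3) WORD #19, for A5): integers `XH XA` (the two top-cell values), `sH sA` (the two labelled `NX`-sums), `cH cA` (the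
solved constants, ★ `cellValue_of_perCellLaw` with `topCell_density`), with `XH = cH·sH`, `N < d → XA = cA·sA`, the sign letter `cA = −cH`, and the ONE arithmetic input
`sH + (if N < d then sA else 0) = 0` (★ (g-top) p864688 after the class partition of the `NX`-sphere; far: one class) ⟹ **`XH = if N < d then XA else 0`** — ★ (P1)'s `htop`.
[cite: Kottwitz1986BaseChangeUnits, §1 pp. 240–241] [cite: Rogawski1990, §4.9 Prop. 4.9.1 (b) p. 55] -/
theorem htop_of_solved (XH XA sH sA cH cA : ℤ) (N d : ℕ) (hXH : XH = cH * sH) (hXA : N < d → XA = cA * sA) (hc : cA = -cH)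
    (hs : sH + (if N < d then sA else 0) = 0) : XH = if N < d then XA else 0 := by
  split_ifs at hs ⊢ with hNd
  · rw [hXH, hXA hNd, hc]; linear_combination cH * hs
  · rw [add_zero] at hs; rw [hXH, hs, mul_zero]

end Summit.HodgeConjecture.HodgeConjecture.Cruxes.H413.F0P3cDyRamTopCellDensity

end
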